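import Summits.Ventures.PercRepro.RankLevelSetRuleQSliceMapBorder
import Summits.Ventures.PercRepro.RankLevelSetRuleQSliceFirstUntruncTwo
import Summits.Ventures.PercRepro.RankLevelSetRuleQSliceSecondUntruncTwo
import Summits.Ventures.PercRepro.RankLevelSetRuleQSliceMapsAllD

/-!
# PercRepro — THE MAP OF RULE Q ON EVERY FAMILY `k ≥ 5`: THE STATEMENT OF RECORD (night-1, gen 21; dossier §32.4)

One theorem collecting what the tree says about the slices `u = q − #P` of the cells `(q+k, q)`, every family `k ≥ 5`:
* **`ruleQ_slice_map_of_record (k) (5 ≤ k)`** —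
  (1) the end slices `u ≤ 1` are paid on every cell; (2) every truncated slice `2 ≤ u ≤ k − 3` FAILS on some cell
  (`not_rhat_slice_of_two_le`, gen 20); (3) the borderline `u = k − 2` is paid on every cell (`rhat_borderline_all`, the conjecture
  of record §28.7); (4) the first untruncated slice `u = k − 1` is paid on every cell `k − 1 ≤ q ≤ k² − 1`
  (`first_untrunc_slice_complete`); (5) the second untruncated slice `u = k` is paid on every cell `k ≤ q ≤ k² + k`
  (`second_untrunc_slice_complete`);
* **`ruleQ_slice_map_of_record_matroid`** — the same at the matroid level (every finite matroid, tight layer);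
* for `k ≤ 10` the map is complete and exact: `rhat_slice_iff_le_ten` / `ruleQ_slice_iff_le_ten`.
What is NOT in the tree (recorded, not claimed): the untruncated slices `u ≥ k − 1` at large `q` (`q ≥ k²` resp. `> k² + k`)
and `u ≥ k + 1` beyond p4's whole-cell theorems. Axioms: standard.
-/

namespace PercRepro

open Set Matroid Finset

/-- **THE MAP OF RULE Q ON THE FAMILY `k ≥ 5`, AS THE TREE KNOWS IT** (arithmetic level). -/
theorem ruleQ_slice_map_of_record (k : ℕ) (hk : 5 ≤ k) :
    (∀ u, u ≤ 1 → ∀ q, u ≤ q → phiK (q + k) q ≤ rhat q k (q - u))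
    ∧ (∀ u, 2 ≤ u → u + 3 ≤ k → ¬ ∀ q, u ≤ q → phiK (q + k) q ≤ rhat q k (q - u))
    ∧ (∀ q, k - 2 ≤ q → phiK (q + k) q ≤ rhat q k (q - (k - 2)))
    ∧ (∀ q, k - 1 ≤ q → q + 1 ≤ k * k → phiK (q + k) q ≤ rhat q k (q - (k - 1)))
    ∧ (∀ q, k ≤ q → q ≤ k * k + k → phiK (q + k) q ≤ rhat q k (q - k)) := by
  refine ⟨fun u hu q hq => rhat_slice_of_le_one_or_border k u hk (Or.inl hu) q hq,
    fun u hu huk => not_rhat_slice_of_two_le k u hk hu huk,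
    fun q hq => rhat_borderline_all k q hk hq,
    fun q hq hq' => first_untrunc_slice_complete k q hk hq hq',
    fun q hq hq' => second_untrunc_slice_complete k q hk hq hq'⟩

/-- **THE MAP AT THE MATROID LEVEL**: at the tight layer of every finite matroid, for every family `k ≥ 5` —
the members with `#P ≥ q − 1`, with `#P = q − (k−2)`, with `#P = q − (k−1)` on `k − 1 ≤ q ≤ k² − 1`, and with `#P = q − k` on
`k ≤ q ≤ k² + k` are paid by Rule Q's equal split; and for every `2 ≤ u ≤ k − 3` some member at distance `u` is not. -/
theorem ruleQ_slice_map_of_record_matroid (k : ℕ) (hk : 5 ≤ k) :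
    (∀ (β : Type) (M : Matroid β) (hf : M.Finite) (q : ℕ), M.E.ncard = (q + k) + q →
        ∀ Z ∈ cellMembers M (q + k) q, q ≤ (flatPart M Z).ncard + 1 → phiK (q + k) q ≤ @ruleQRecv β M hf (q + k) q Z)
    ∧ (∀ u, 2 ≤ u → u + 3 ≤ k → ∀ q, 4 ^ (k + 3) + u ≤ q →
        ∃ (β : Type) (M : Matroid β) (hf : M.Finite) (Z : Set β), M.E.ncard = (q + k) + q ∧ Z ∈ cellMembers M (q + k) q ∧
          (flatPart M Z).ncard = q - u ∧ @ruleQRecv β M hf (q + k) q Z < phiK (q + k) q)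
    ∧ (∀ (β : Type) (M : Matroid β) (hf : M.Finite) (q : ℕ), k - 2 ≤ q → M.E.ncard = (q + k) + q →
        ∀ Z ∈ cellMembers M (q + k) q, (flatPart M Z).ncard = q - (k - 2) → phiK (q + k) q ≤ @ruleQRecv β M hf (q + k) q Z)
    ∧ (∀ (β : Type) (M : Matroid β) (hf : M.Finite) (q : ℕ), k - 1 ≤ q → q + 1 ≤ k * k → M.E.ncard = (q + k) + q →
        ∀ Z ∈ cellMembers M (q + k) q, (flatPart M Z).ncard = q - (k - 1) → phiK (q + k) q ≤ @ruleQRecv β M hf (q + k) q Z)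
    ∧ (∀ (β : Type) (M : Matroid β) (hf : M.Finite) (q : ℕ), k ≤ q → q ≤ k * k + k → M.E.ncard = (q + k) + q →
        ∀ Z ∈ cellMembers M (q + k) q, (flatPart M Z).ncard = q - k → phiK (q + k) q ≤ @ruleQRecv β M hf (q + k) q Z) := by
  refine ⟨fun β M hf q hE Z hZ hP => @ruleQRecv_ge_phiK_of_top β M hf q k (by omega) hE Z hZ hP,
    fun u hu huk q hq => exists_unpaid_slice k u hk hu huk q hq,
    fun β M hf q hq hE Z hZ hP => @ruleQRecv_ge_phiK_borderline_all β M hf q k hk hq hE Z hZ hP,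
    fun β M hf q hq hq' hE Z hZ hP => @ruleQRecv_ge_phiK_first_untrunc_complete β M hf q k hk hq hq' hE Z hZ hP,
    fun β M hf q hq hq' hE Z hZ hP => @ruleQRecv_ge_phiK_second_untrunc_complete β M hf q k hk hq hq' hE Z hZ hP⟩

end PercRepro
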